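import Literature.MathematicalPhysics.QuantumFieldTheory.Balaban1983to89.B13JointWalkExpansionAlgebra

/-!
# `Balaban1983to89.B13Eq111SDecoupling` — T. Bałaban, *Renormalization group approach to lattice gauge field
theories. II. Cluster expansions*, Commun. Math. Phys. **116** (1988) 1–22 [Balaban1988RG2Cluster], p. 3 ll. 30–36,
(1.11) p. 5 and p. 13: THE s-DECOUPLING OF A WALK EXPANSION — *"for a random walk ω localized in X̃₀⁵ ∪ … ∪ X̃ₙ⁵ we
take the {Δ₁,…,Δ_m} of all cubes from σ₀ which intersect this localization domain, and we multiply the term in (1.6)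
corresponding to ω by ∏_{j=1}^m s(Δ_j). This way the s-dependent propagators H(s), G(s), H₀(s) are defined. They
coincide with the original ones for s = 1."* — as a CONSTRUCTION on the tree's joint-walk-expansion shape: a σ-FREE
expansion (the propagators of [13] Thm 3.10, (1.6)–(1.7)) decorated by s-monomials IS a `JointWalkExpansion` with
the σ-carrying sub-family `{m(ω) ≥ 1}`, on the polydisc `|s(Δ)| ≤ e^{κ₁}` — the typed content of (1.11)

statement-level skeleton of published theorems with citation tags; proofs where landed; nothing here is a claim about
the Yang–Mills mass gap

CITATION HEADER (held scan `paper:balaban1988-cmp116-rg-ii-cluster`, text layer p0003 ll. 30–36, p0005 ll. 9–20, p0013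
ll. 12–23, read this session).  (1.11) p. 5: *"the parameters s(Y₀) are complex valued and satisfy the bound
|s(Δ)| ≤ e^{κ₁} for Δ ⊂ Y₀∖□̃⁴, κ₁ is a sufficiently big positive number. Using the bound (1.7) we estimate the function
by B₀|X| sup_ω M₁^{−½|ω|} exp(−δ₀d(ω)) e^{mκ₁} (1.11) where d(ω) is a length of a shortest tree graph intersecting all
localization domains of ω, m is the number of the parameters s connected with the walk ω. If m is big enough, for
example m > 2⁴, then δ₀d(ω) ≥ δ₁mM, for a positive constant δ₁ depending on δ₀ only, and we can bound the expression
under the supremum in (1.11) by 1, for δ₁M ≥ κ₁. If m ≤ 2⁴, then we can have short walks, in fact with |ω| = 0, and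
the expression can be bounded by e^{16κ₁} only. Thus the function H(s(Y₀))X is an analytic function of the variables
s(Y₀) on the domain |s(Y₀)| ≤ e^{κ₁}, bounded by B₀e^{16κ₁}|X| in all norms of Theorems 3.1.-3.10 [13]."*; p. 13
ll. 14–23: *"The parameters s(Δ), Δ ∈ σ₀, are introduced into the operators as before … For this class of localization
domains we construct the generalized random walk expansions."*

WHY (cell `pub-ymgap`, node N10; FAN-OUT v1.1 §N10 s1 ∕ §N06 s4).  The rung `UniformWalksAcross 𝓣_Bałaban q` needs
`JointWalkExpansion`s — σ-dependent, with a σ-carrying sub-family passing through the σ-region — of kernels built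
from the propagators of [13].  Node N06 supplies the σ-FREE expansions ([13] Thm 3.10, typed as
`B13Sect1Statements.Eq16_17` over the [13]-carriers); `B13JointWalkExpansionAlgebra` closes the shape under the
operator algebra; the present file is the remaining printed construction step — HOW σ ENTERS: the s-monomial
decoration of p. 3, with its (1.11) bound.  The tree had this only for walks of length `≤ 1`
(`B13LocalKernelWalks.jointWalkExpansion_local`, decoration built into the one-step datum).

WHAT THIS FILE PROVIDES.
§1 `sTerm J T₀` (the decorated term `(∏_{Δ∈J(ω)} s(Δ))·T_ω(u)`), `sDecorate J T₀` (the s-dependent kernel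
   `Σ_ω sTerm`, DEFINED by the series, p. 3 *"This way the s-dependent propagators … are defined"*) — two MODEL
   definitions with bodies; `sTerm_apply`, `sTerm_one` (*"They coincide with the original ones for s = 1"*, termwise),
   `sTerm_of_empty` (a walk meeting no cube of σ₀ keeps its term), `norm_sTerm_le` (the (1.11) mechanism: on the polydisc
   `‖∏ s‖ ≤ e^{κ₁m}`, and the ABSORPTION HYPOTHESIS `κ₁·m(ω) ≤ κ₁·m₀ + η·D_ω` — print's dichotomy `m ≤ 2⁴` ∕
   `δ₀d(ω) ≥ δ₁mM, δ₁M ≥ κ₁`, whose repaired geometric form is the tree's `B13WalkCubes111.walkCubes_dichotomy` ∕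
   `supFactor_le_one ∕ _short` — turns `A_ωe^{−ρD_ω}` into `e^{κ₁m₀}A_ωe^{−(ρ−η)D_ω}`).
§2 **`jointWalkExpansion_sDecorate`**: a σ-free joint walk expansion of `K₀(u) = Σ_ω T_ω(u)` (package `(ρ, ε, κ, K̄)`),
   a decoration `J` obeying the absorption hypothesis with `η ≤ ε`, and the geometric clause *a walk that picks up
   a parameter passes through the σ-region `X`* give: `sDecorate J T₀` is a `JointWalkExpansion` with terms `sTerm J T₀`,
   σ-carrying sub-family `{ω | J(ω) ≠ ∅}`, amplitudes `e^{κ₁m₀}A_ω`, the SAME walk distances, rate `ρ − η`, drop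
   `ε − η`, torus rate `κ`, constant `e^{κ₁m₀}K̄`; `hasSum_sDecorate`; `sDecorate_one` (at `s ≡ 1` the decorated kernel
   IS `K₀`); `sDecorate_entry_le` (the (1.11)-type uniform bound `e^{κ₁m₀}K̄e^{−κd₁}` on polydisc × ball).
§3 Non-vacuity: `jointWalkExpansion_sDecorate_const` — a σ-free localised kernel decorated by ONE parameter.
§4 (second edition) THE ABSORPTION BINDER DISCHARGED FROM PRINT'S TWO LOCATED CLAUSES (p. 5 after (1.11)):
   `absorb_of_dichotomy` — the dichotomy (P1) `m(ω) ≤ m₀ ∨ ∀ a b, δ₁M·m(ω) ≤ ρ·D_ω(a,b)` (*"If m is big enough, for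
   example m > 2⁴, then δ₀d(ω) ≥ δ₁mM"*, `ρ` = `δ₀`, `D_ω(a,b) = d(ω,a,b) ≥ d(ω)`) and the restriction (P2) `κ₁ρ ≤ η·δ₁M`
   (*"for δ₁M ≥ κ₁"*, the absorbed rate `η` explicit) IMPLY `habs`; `dichotomy_of_treeLength` (print's sentence in its
   own currency `d(ω)` + the (3.93) domination `d(ω) ≤ d(ω,a,b)` ⟹ (P1)); **`jointWalkExpansion_sDecorate_of_dichotomy`**,
   `sDecorate_entry_le_of_dichotomy` (§2 from (P1) + (P2)); `jointWalkExpansion_sDecorate_printed` (`m₀ = 2⁴`, `η = ε`: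
   drop `0`, constant `e^{16κ₁}K̄`); `sDecorate_entry_le_R1` (print's own package, drop `ε = ρ`: (P2) LITERALLY
   `κ₁ ≤ δ₁M`, bound `e^{16κ₁}K̄e^{−κd₁}` = *"bounded by B₀e^{16κ₁}|X|"*).
§5 `jointWalkExpansion_sDecorate_longWalk` — non-vacuity with the LONG branch of (P1) in use (`m > 2⁴` parameters on
   one term, walk distance `D_X + ℓ`).
HONEST FRAMING: a kernel-level CONSTRUCTION on the tree's hypothesis shape (finite matrices on the unit torus,
absolutely convergent series); the absorption hypothesis of §1–§2 is a named binder, DISCHARGED in §4 from print's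
dichotomy (P1) — itself a hypothesis on the walk data here (its geometric content for Bałaban's σ₀-cubes and
domains lives on another carrier: as printed it FAILS without a size threshold, `B13WalkCubes111.printed111_fails`;
repaired, it is `B13WalkCubes111.walkCubes_dichotomy_walkLen` ∕ `ineq111_long`) — and print's restriction (P2)
(`δ₁M ≥ κ₁` verbatim when the whole walk decay is spare, `δ₁M ≥ (ρ/η)κ₁` when only the drop `η ≤ ε < ρ` is);
NOTHING of Bałaban's `H(s)`, `G(s)`, `H₀(s)`, `Δ_k(σ)` is constructed from HIS propagators here — their σ-free
expansions ([13] Thm 3.10, node N06 ∕ cell GAPS G-B9-10) remain the INPUT; count-neutral; NOT a discharge of N10; no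
new named fact (two model `def`s with bodies, no `Prop` placeholders); no instance, no notation; NOT [B12] Thm 2,
nothing continuum ∕ ℝ⁴ ∕ mass gap ∕ Clay.
-/

noncomputable section

namespace Literature.MathematicalPhysics.QuantumFieldTheory.Balaban1983to89.B13Eq111SDecoupling

open Metric Set Finset
open Literature.MathematicalPhysics.QuantumFieldTheory.Balaban1983to89
open Literature.MathematicalPhysics.QuantumFieldTheory.Balaban1983to89.B9SectDWalk
  (Through MajSumLe DomBy passDist passDist_le domBy_passDist through_passDist)
open Literature.MathematicalPhysics.QuantumFieldTheory.Balaban1983to89.B9Thm34Ext (toB6)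
open Literature.MathematicalPhysics.QuantumFieldTheory.Balaban1983to89.B9Thm37GlueTorus
  (torusGeom tdist1 tdist1_nonneg htri_torusGeom)
open Literature.MathematicalPhysics.QuantumFieldTheory.Balaban1983to89.TreeLengthTorus (TPt)
open Literature.MathematicalPhysics.QuantumFieldTheory.Balaban1983to89.B5TorusCover (UT)
open Literature.MathematicalPhysics.QuantumFieldTheory.Balaban1983to89.B13JointWalkExpansion
  (JointWalkExpansion jointWalkExpansion_const)
open Literature.MathematicalPhysics.QuantumFieldTheory.Balaban1983to89.B13LocalKernelWalks.LocalTerms (norm_monomial_le)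
open Literature.MathematicalPhysics.QuantumFieldTheory.Balaban1983to89.B13JointWalkExpansionAlgebra
  (summable_majorant_of_majSumLe)

variable {ν : ℕ} {Nf : Fin ν → ℕ} [∀ i, NeZero (Nf i)]
variable {d N' : ℕ} {p n : Type}
variable {E : Type*}
variable {W : Type}

/-! ## §1. The decorated terms and the s-dependent kernel -/

/-- MODEL.  **The s-DECORATED WALK TERM**: the term `T_ω(u)` of a σ-free expansion multiplied by the monomial
`∏_{Δ ∈ J(ω)} s(Δ)` of the parameters of the σ₀-cubes `J(ω)` meeting the localization of `ω` (p. 3: *"we multiply the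
term in (1.6) corresponding to ω by ∏_{j=1}^m s(Δ_j)"*). [cite: Balaban1988RG2Cluster, p.3 (after (1.7)), (1.11) p.5] -/
def sTerm (J : W → Finset (TPt d N')) (T₀ : W → E → Matrix p n ℂ) : W → (TPt d N' → ℂ) → E → Matrix p n ℂ :=
  fun ω σ u => (∏ k ∈ J ω, σ k) • T₀ ω u

/-- MODEL.  **The s-DEPENDENT KERNEL** `K(s,u) = Σ_ω (∏_{Δ∈J(ω)} s(Δ))·T_ω(u)`, DEFINED entrywise by the series (p. 3:
*"This way the s-dependent propagators H(s), G(s), H₀(s) are defined."*; convergence on the polydisc is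
`hasSum_sDecorate`). [cite: Balaban1988RG2Cluster, p.3 (after (1.7)), (1.11) p.5, p.13] -/
def sDecorate (J : W → Finset (TPt d N')) (T₀ : W → E → Matrix p n ℂ) : (TPt d N' → ℂ) → E → Matrix p n ℂ :=
  fun σ u => Matrix.of fun i j => ∑' ω, sTerm J T₀ ω σ u i j

variable (J : W → Finset (TPt d N')) (T₀ : W → E → Matrix p n ℂ)

/-- Entry formula of a decorated term. [cite: Balaban1988RG2Cluster, (1.11) p.5] -/
theorem sTerm_apply (ω : W) (σ : TPt d N' → ℂ) (u : E) (i : p) (j : n) :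
    sTerm J T₀ ω σ u i j = (∏ k ∈ J ω, σ k) * T₀ ω u i j := by
  simp [sTerm, Matrix.smul_apply, smul_eq_mul]

/-- Entry formula of the s-dependent kernel (the defining series). [cite: Balaban1988RG2Cluster, p.3 (after (1.7))] -/
theorem sDecorate_apply (σ : TPt d N' → ℂ) (u : E) (i : p) (j : n) :
    sDecorate J T₀ σ u i j = ∑' ω, sTerm J T₀ ω σ u i j := by
  simp [sDecorate]

/-- *"They coincide with the original ones for s = 1"* — termwise: at `s ≡ 1` the decorated term is the original
term. [cite: Balaban1988RG2Cluster, p.3 (after (1.7))] -/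
theorem sTerm_one (ω : W) (u : E) : sTerm J T₀ ω (fun _ => 1) u = T₀ ω u := by
  simp [sTerm]

/-- A walk whose localization meets NO cube of σ₀ (`J(ω) = ∅`, print's `m = 0`) keeps its term for every `s`.
[cite: Balaban1988RG2Cluster, (1.11) p.5] -/
theorem sTerm_of_empty {ω : W} (hω : J ω = ∅) (σ : TPt d N' → ℂ) (u : E) : sTerm J T₀ ω σ u = T₀ ω u := by
  simp [sTerm, hω]

omit [∀ i, NeZero (Nf i)] in
/-- **THE MECHANISM OF (1.11)**: on the polydisc `‖s(Δ)‖ ≤ e^{κ₁}` (`κ₁ ≥ 0`) the monomial costs `e^{κ₁m(ω)}`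
(`m(ω) = |J(ω)|`, *"m is the number of the parameters s connected with the walk ω"*); under the ABSORPTION HYPOTHESIS
`κ₁m(ω) ≤ κ₁m₀ + ηD_ω(a,b)` (print: `m ≤ 2⁴`, else `δ₀d(ω) ≥ δ₁mM` with `δ₁M ≥ κ₁`) a per-term bound `A_ωe^{−ρD_ω}` of the
σ-free term becomes `e^{κ₁m₀}A_ω·e^{−(ρ−η)D_ω}` for the decorated term. [cite: Balaban1988RG2Cluster, (1.11) p.5] -/
theorem norm_sTerm_le {c : B13.Consts} (hκ₁ : 0 ≤ c.κ₁) {locp : p → UT Nf} {locn : n → UT Nf} {A : W → ℝ}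
    {D : W → UT Nf → UT Nf → ℝ} {ρ η : ℝ} {m₀ : ℕ}
    (habs : ∀ ω a b, c.κ₁ * (J ω).card ≤ c.κ₁ * m₀ + η * D ω a b)
    (ω : W) {σ : TPt d N' → ℂ} (hσ : ∀ j, ‖σ j‖ ≤ Real.exp c.κ₁) {u : E} (i : p) (j : n)
    (hT : ‖T₀ ω u i j‖ ≤ A ω * Real.exp (-(ρ * D ω (locp i) (locn j)))) :
    ‖sTerm J T₀ ω σ u i j‖ ≤ (Real.exp (c.κ₁ * m₀) * A ω) * Real.exp (-((ρ - η) * D ω (locp i) (locn j))) := by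
  rw [sTerm_apply, norm_mul]
  have hmon : ‖∏ k ∈ J ω, σ k‖ ≤ Real.exp (c.κ₁ * (J ω).card) := norm_monomial_le hκ₁ le_rfl σ hσ
  have hmon' : ‖∏ k ∈ J ω, σ k‖ ≤ Real.exp (c.κ₁ * m₀) * Real.exp (η * D ω (locp i) (locn j)) := by
    rw [← Real.exp_add]
    exact hmon.trans (Real.exp_le_exp.2 (habs ω (locp i) (locn j)))
  calc ‖∏ k ∈ J ω, σ k‖ * ‖T₀ ω u i j‖
      ≤ (Real.exp (c.κ₁ * m₀) * Real.exp (η * D ω (locp i) (locn j))) *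
          (A ω * Real.exp (-(ρ * D ω (locp i) (locn j)))) :=
        mul_le_mul hmon' hT (norm_nonneg _) (by positivity)
    _ = (Real.exp (c.κ₁ * m₀) * A ω) * Real.exp (-((ρ - η) * D ω (locp i) (locn j))) := by
        have e : Real.exp (η * D ω (locp i) (locn j)) * Real.exp (-(ρ * D ω (locp i) (locn j))) =
            Real.exp (-((ρ - η) * D ω (locp i) (locn j))) := by
          rw [← Real.exp_add]; congr 1; ring
        calc (Real.exp (c.κ₁ * m₀) * Real.exp (η * D ω (locp i) (locn j))) *
              (A ω * Real.exp (-(ρ * D ω (locp i) (locn j))))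
            = (Real.exp (c.κ₁ * m₀) * A ω) *
                (Real.exp (η * D ω (locp i) (locn j)) * Real.exp (-(ρ * D ω (locp i) (locn j)))) := by ring
          _ = _ := by rw [e]

/-! ## §2. The theorem: the s-decoupled expansion IS a joint walk expansion on the polydisc -/

section Decorate

variable [NormedAddCommGroup E] [NormedSpace ℂ E]
variable {c : B13.Consts} {locp : p → UT Nf} {locn : n → UT Nf} {K₀ : E → Matrix p n ℂ}
variable {X : Finset (UT Nf)} {R ε kap Kbar : ℝ} {SX₀ : Set W} {A : W → ℝ} {D : W → UT Nf → UT Nf → ℝ} {ρ : ℝ}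
variable {J T₀}

/-- **THE s-DECOUPLED EXPANSION IS A JOINT WALK EXPANSION** ((1.6)–(1.7) ⟹ (1.11)).  DATA: a σ-FREE joint walk
expansion of `K₀(u) = Σ_ω T_ω(u)` (package `(ρ, ε, κ, K̄)` — the propagators of [13] Thm 3.10 at complex backgrounds,
typed σ-free: kernel and terms constant in σ), a decoration `J(ω)` (the σ₀-cubes meeting the localization of `ω`)
obeying the absorption hypothesis `κ₁m(ω) ≤ κ₁m₀ + ηD_ω` with `0 ≤ η ≤ ε`, and the geometric clause that a walk
picking up a parameter PASSES THROUGH the σ-region `X` (p. 13: the cubes of σ₀ lie outside `Z̃₀`; (3.93): a walk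
distance passes through every localization it visits).  CONCLUSION: `K(s,u) = Σ_ω (∏_{Δ∈J(ω)} s(Δ))T_ω(u)` is a
joint walk expansion on the polydisc `‖s(Δ)‖ ≤ e^{κ₁}` × the `R`-ball with terms `sTerm J T₀`, σ-carrying sub-family
`{ω | J(ω) ≠ ∅}` (a term with `m(ω) = 0` is σ-free — `indep`), amplitudes `e^{κ₁m₀}A_ω`, the SAME walk distances,
rate `ρ − η`, drop `ε − η`, torus rate `κ`, constant `e^{κ₁m₀}K̄` — print's *"analytic function of the variables s(Y₀)
on the domain |s(Y₀)| ≤ e^{κ₁}, bounded by B₀e^{16κ₁}|X|"* with `m₀ = 16`. [cite: Balaban1988RG2Cluster, p.3 (after (1.7)), (1.11) p.5, p.13; Balaban1985BackgroundPropagators, Thm 3.10 (3.107)–(3.108) p.416, (3.93) p.410] -/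
theorem jointWalkExpansion_sDecorate (hκ₁ : 0 ≤ c.κ₁)
    (h₀ : JointWalkExpansion c locp locn (fun (_ : TPt d N' → ℂ) => K₀) X R ε kap Kbar
      (fun ω (_ : TPt d N' → ℂ) => T₀ ω) SX₀ A D ρ)
    (J : W → Finset (TPt d N')) {m₀ : ℕ} {η : ℝ} (hηε : η ≤ ε)
    (habs : ∀ ω a b, c.κ₁ * (J ω).card ≤ c.κ₁ * m₀ + η * D ω a b)
    (hX : ∀ ω, (J ω).Nonempty → Through (toB6 (torusGeom Nf 0 0 0) 0 True) (D ω) (↑X : Set (UT Nf))) :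
    JointWalkExpansion c locp locn (sDecorate J T₀) X R (ε - η) kap (Real.exp (c.κ₁ * m₀) * Kbar)
      (sTerm J T₀) {ω | (J ω).Nonempty} (fun ω => Real.exp (c.κ₁ * m₀) * A ω) D (ρ - η) where
  hasSum σ hσ u hu i j := by
    rw [sDecorate_apply]
    refine (Summable.of_norm_bounded (g := fun ω => (Real.exp (c.κ₁ * m₀) * A ω) *
        Real.exp (-((ρ - η) * D ω (locp i) (locn j)))) ?_ fun ω => ?_).hasSum
    · have hs := summable_majorant_of_majSumLe (ρ := ρ - η) h₀.A_nonneg h₀.D_nonneg (by linarith) h₀.majSum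
        (locp i) (locn j)
      simpa [mul_assoc] using hs.mul_left (Real.exp (c.κ₁ * m₀))
    · exact norm_sTerm_le J T₀ hκ₁ habs ω hσ i j (h₀.maj ω σ hσ u hu i j)
  termAnalytic ω σ hσ i j := by
    have e : (fun u => sTerm J T₀ ω σ u i j) = fun u => (∏ k ∈ J ω, σ k) * T₀ ω u i j :=
      funext fun u => sTerm_apply J T₀ ω σ u i j
    rw [e]
    exact (h₀.termAnalytic ω σ hσ i j).const_mul _
  maj ω σ hσ u hu i j := norm_sTerm_le J T₀ hκ₁ habs ω hσ i j (h₀.maj ω σ hσ u hu i j)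
  majSum S a b := by
    have hs := h₀.majSum S a b
    have e : ∀ ω, (Real.exp (c.κ₁ * m₀) * A ω) * Real.exp (-((ρ - η - (ε - η)) * D ω a b)) =
        Real.exp (c.κ₁ * m₀) * (A ω * Real.exp (-((ρ - ε) * D ω a b))) := fun ω => by
      have : ρ - η - (ε - η) = ρ - ε := by ring
      rw [this]; ring
    calc ∑ ω ∈ S, (Real.exp (c.κ₁ * m₀) * A ω) * Real.exp (-((ρ - η - (ε - η)) * D ω a b))
        = Real.exp (c.κ₁ * m₀) * ∑ ω ∈ S, A ω * Real.exp (-((ρ - ε) * D ω a b)) := by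
          rw [Finset.mul_sum]; exact Finset.sum_congr rfl fun ω _ => e ω
      _ ≤ Real.exp (c.κ₁ * m₀) * (Kbar * Real.exp (-(kap * tdist1 Nf a b))) :=
          mul_le_mul_of_nonneg_left hs (Real.exp_pos _).le
      _ = Real.exp (c.κ₁ * m₀) * Kbar * Real.exp (-(kap * tdist1 Nf a b)) := by ring
  indep ω hω σ hσ := by
    have hJ : J ω = ∅ := Finset.not_nonempty_iff_eq_empty.1 hω
    rw [sTerm_of_empty J T₀ hJ, sTerm_of_empty J T₀ hJ]
  through ω hω := hX ω hω
  A_nonneg ω := mul_nonneg (Real.exp_pos _).le (h₀.A_nonneg ω)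
  D_nonneg := h₀.D_nonneg

/-- **Convergence of the defining series** on polydisc × ball (the `hasSum` field, by name).
[cite: Balaban1988RG2Cluster, p.3 (after (1.7)), (1.11) p.5] -/
theorem hasSum_sDecorate (hκ₁ : 0 ≤ c.κ₁)
    (h₀ : JointWalkExpansion c locp locn (fun (_ : TPt d N' → ℂ) => K₀) X R ε kap Kbar
      (fun ω (_ : TPt d N' → ℂ) => T₀ ω) SX₀ A D ρ)
    (J : W → Finset (TPt d N')) {m₀ : ℕ} {η : ℝ} (hηε : η ≤ ε)
    (habs : ∀ ω a b, c.κ₁ * (J ω).card ≤ c.κ₁ * m₀ + η * D ω a b)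
    (hX : ∀ ω, (J ω).Nonempty → Through (toB6 (torusGeom Nf 0 0 0) 0 True) (D ω) (↑X : Set (UT Nf)))
    {σ : TPt d N' → ℂ} (hσ : ∀ j, ‖σ j‖ ≤ Real.exp c.κ₁) {u : E} (hu : u ∈ ball (0 : E) R) (i : p) (j : n) :
    HasSum (fun ω => sTerm J T₀ ω σ u i j) (sDecorate J T₀ σ u i j) :=
  (jointWalkExpansion_sDecorate hκ₁ h₀ J hηε habs hX).hasSum σ hσ u hu i j

/-- *"They coincide with the original ones for s = 1"*: at `s ≡ 1` (a point of the polydisc, `κ₁ ≥ 0`) the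
s-dependent kernel IS the σ-free kernel `K₀(u)` on the `R`-ball. [cite: Balaban1988RG2Cluster, p.3 (after (1.7))] -/
theorem sDecorate_one (hκ₁ : 0 ≤ c.κ₁)
    (h₀ : JointWalkExpansion c locp locn (fun (_ : TPt d N' → ℂ) => K₀) X R ε kap Kbar
      (fun ω (_ : TPt d N' → ℂ) => T₀ ω) SX₀ A D ρ)
    (J : W → Finset (TPt d N')) {m₀ : ℕ} {η : ℝ} (hηε : η ≤ ε)
    (habs : ∀ ω a b, c.κ₁ * (J ω).card ≤ c.κ₁ * m₀ + η * D ω a b)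
    (hX : ∀ ω, (J ω).Nonempty → Through (toB6 (torusGeom Nf 0 0 0) 0 True) (D ω) (↑X : Set (UT Nf)))
    {u : E} (hu : u ∈ ball (0 : E) R) : sDecorate J T₀ (fun _ => 1) u = K₀ u := by
  have h1 : ∀ j : TPt d N', ‖(fun _ : TPt d N' => (1 : ℂ)) j‖ ≤ Real.exp c.κ₁ := fun _ => by
    simpa using Real.one_le_exp hκ₁
  ext i j
  have hd := hasSum_sDecorate hκ₁ h₀ J hηε habs hX h1 hu i j
  have hK : HasSum (fun ω => sTerm J T₀ ω (fun _ => 1) u i j) (K₀ u i j) := by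
    have e : (fun ω => sTerm J T₀ ω (fun _ => (1 : ℂ)) u i j) = fun ω => T₀ ω u i j :=
      funext fun ω => by rw [sTerm_one]
    rw [e]
    exact h₀.hasSum (fun _ => 1) h1 u hu i j
  exact hd.unique hK

/-- **THE (1.11)-TYPE UNIFORM BOUND of the s-dependent kernel**: `‖K(s,u)(i,j)‖ ≤ e^{κ₁m₀}K̄·e^{−κd₁(loc i, loc j)}` on
polydisc × ball (`JointWalkExpansion.majorants` of the decorated expansion) — print's *"bounded by B₀e^{16κ₁}|X| in
all norms"*, entrywise. [cite: Balaban1988RG2Cluster, (1.11) p.5] -/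
theorem sDecorate_entry_le (hκ₁ : 0 ≤ c.κ₁)
    (h₀ : JointWalkExpansion c locp locn (fun (_ : TPt d N' → ℂ) => K₀) X R ε kap Kbar
      (fun ω (_ : TPt d N' → ℂ) => T₀ ω) SX₀ A D ρ)
    (J : W → Finset (TPt d N')) {m₀ : ℕ} {η : ℝ} (hηε : η ≤ ε)
    (habs : ∀ ω a b, c.κ₁ * (J ω).card ≤ c.κ₁ * m₀ + η * D ω a b)
    (hX : ∀ ω, (J ω).Nonempty → Through (toB6 (torusGeom Nf 0 0 0) 0 True) (D ω) (↑X : Set (UT Nf))) :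
    ∀ σ : TPt d N' → ℂ, (∀ j, ‖σ j‖ ≤ Real.exp c.κ₁) → ∀ u ∈ ball (0 : E) R,
      ∀ i j, ‖sDecorate J T₀ σ u i j‖ ≤
        (Real.exp (c.κ₁ * m₀) * Kbar) * Real.exp (-(kap * tdist1 Nf (locp i) (locn j))) :=
  (jointWalkExpansion_sDecorate hκ₁ h₀ J hηε habs hX).majorants (by linarith)

/-- The undecorated case `J ≡ ∅` (no cube of σ₀ meets any walk): the s-dependent kernel is `K₀` for EVERY `s`.
[cite: Balaban1988RG2Cluster, (1.11) p.5] -/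
theorem sDecorate_empty (h₀ : JointWalkExpansion c locp locn (fun (_ : TPt d N' → ℂ) => K₀) X R ε kap Kbar
      (fun ω (_ : TPt d N' → ℂ) => T₀ ω) SX₀ A D ρ)
    (σ : TPt d N' → ℂ) {u : E} (hu : u ∈ ball (0 : E) R) (hpoly : ∃ σ₁ : TPt d N' → ℂ, ∀ j, ‖σ₁ j‖ ≤ Real.exp c.κ₁) :
    sDecorate (fun _ => (∅ : Finset (TPt d N'))) T₀ σ u = K₀ u := by
  obtain ⟨σ₁, hσ₁⟩ := hpoly
  ext i j
  rw [sDecorate_apply]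
  have e : (fun ω => sTerm (fun _ => (∅ : Finset (TPt d N'))) T₀ ω σ u i j) = fun ω => T₀ ω u i j :=
    funext fun ω => by rw [sTerm_of_empty _ T₀ rfl]
  rw [e]
  exact (h₀.hasSum σ₁ hσ₁ u hu i j).tsum_eq

end Decorate

/-! ## §3. Non-vacuity: a σ-free localised kernel decorated by ONE parameter -/

section NonVacuity

variable [NormedAddCommGroup E] [NormedSpace ℂ E]
variable {c : B13.Consts} {locp : p → UT Nf} {locn : n → UT Nf}

/-- **The construction is inhabited with a NON-EMPTY σ-carrying family**: a σ-free, u-free kernel `K₀` localised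
through a non-empty set `X` (`‖K₀(i,j)‖ ≤ A₀e^{−ρD_X(loc i, loc j)}`, `D_X` the one-junction distance (3.93) through
`X`), read as its own one-term expansion (`jointWalkExpansion_const`), decorated by the single parameter `j₀`
(`J ≡ {j₀}`, `m₀ = 1`, `η = 0`): `K(s) = s(j₀)·K₀` is a joint walk expansion whose ONLY term carries σ (`SX = univ`)
and passes through `X`, with constant `e^{κ₁}A₀`, drop `ε ≥ 0`, torus rate `0 ≤ κ ≤ ρ − ε`. [cite: Balaban1988RG2Cluster, (1.11) p.5, p.13; Balaban1985BackgroundPropagators, (3.93) p.410] -/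
theorem jointWalkExpansion_sDecorate_const (hκ₁ : 0 ≤ c.κ₁) (K₀ : Matrix p n ℂ) {X : Finset (UT Nf)}
    (hX : X.Nonempty) {R ε kap A₀ ρ : ℝ} (hA₀ : 0 ≤ A₀) (hε : 0 ≤ ε) (hkap : 0 ≤ kap) (hκρ : kap ≤ ρ - ε)
    (hmaj : ∀ i j, ‖K₀ i j‖ ≤ A₀ *
      Real.exp (-(ρ * passDist (g := toB6 (torusGeom Nf 0 0 0) 0 True) X hX (locp i) (locn j))))
    (j₀ : TPt d N') :
    JointWalkExpansion c locp locn (sDecorate (fun _ : Unit => ({j₀} : Finset (TPt d N'))) (fun (_ : Unit) (_ : E) => K₀))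
      X R ε kap (Real.exp c.κ₁ * A₀)
      (sTerm (fun _ : Unit => ({j₀} : Finset (TPt d N'))) (fun (_ : Unit) (_ : E) => K₀))
      (Set.univ : Set Unit) (fun _ => Real.exp c.κ₁ * A₀)
      (fun _ => passDist (g := toB6 (torusGeom Nf 0 0 0) 0 True) X hX) ρ := by
  -- the σ-free one-term expansion of the constant kernel, with `D₀ = D_X` (dominates `d₁`, passes through `X`)
  have hD₀ : ∀ a b : UT Nf, 0 ≤ passDist (g := toB6 (torusGeom Nf 0 0 0) 0 True) X hX a b := fun a b =>
    (tdist1_nonneg a b).trans (domBy_passDist (htri_torusGeom 0 0 0 0 True) X hX a b)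
  have hsum : MajSumLe (g := toB6 (torusGeom Nf 0 0 0) 0 True)
      (fun (_ : Unit) a b => A₀ * Real.exp (-((ρ - ε) * passDist (g := toB6 (torusGeom Nf 0 0 0) 0 True) X hX a b)))
      (fun a b => A₀ * Real.exp (-(kap * tdist1 Nf a b))) := by
    intro S a b
    have hdom := domBy_passDist (htri_torusGeom 0 0 0 0 True) X hX a b
    have h1 : A₀ * Real.exp (-((ρ - ε) * passDist (g := toB6 (torusGeom Nf 0 0 0) 0 True) X hX a b)) ≤
        A₀ * Real.exp (-(kap * tdist1 Nf a b)) := by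
      refine mul_le_mul_of_nonneg_left (Real.exp_le_exp.2 (neg_le_neg ?_)) hA₀
      calc kap * tdist1 Nf a b ≤ kap * passDist (g := toB6 (torusGeom Nf 0 0 0) 0 True) X hX a b :=
            mul_le_mul_of_nonneg_left hdom hkap
        _ ≤ (ρ - ε) * passDist (g := toB6 (torusGeom Nf 0 0 0) 0 True) X hX a b :=
            mul_le_mul_of_nonneg_right hκρ (hD₀ a b)
    calc ∑ _ω ∈ S, A₀ * Real.exp (-((ρ - ε) * passDist (g := toB6 (torusGeom Nf 0 0 0) 0 True) X hX a b))
        ≤ ∑ _ω ∈ (Finset.univ : Finset Unit),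
            A₀ * Real.exp (-((ρ - ε) * passDist (g := toB6 (torusGeom Nf 0 0 0) 0 True) X hX a b)) :=
          Finset.sum_le_sum_of_subset_of_nonneg (Finset.subset_univ S) fun _ _ _ =>
            mul_nonneg hA₀ (Real.exp_pos _).le
      _ = A₀ * Real.exp (-((ρ - ε) * passDist (g := toB6 (torusGeom Nf 0 0 0) 0 True) X hX a b)) := by simp
      _ ≤ A₀ * Real.exp (-(kap * tdist1 Nf a b)) := h1
  have h₀ := jointWalkExpansion_const (d := d) (N' := N') (E := E) c locp locn K₀ X (R := R) (ε := ε) hA₀ hD₀ hmaj hsum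
  have habs : ∀ (_ : Unit) (a b : UT Nf), c.κ₁ * (({j₀} : Finset (TPt d N'))).card ≤
      c.κ₁ * (1 : ℕ) + 0 * passDist (g := toB6 (torusGeom Nf 0 0 0) 0 True) X hX a b := fun _ a b => by simp
  have h := jointWalkExpansion_sDecorate (SX₀ := (∅ : Set Unit)) hκ₁ h₀ (fun _ => ({j₀} : Finset (TPt d N')))
    (m₀ := 1) (η := 0) hε habs (fun _ _ => through_passDist (g := toB6 (torusGeom Nf 0 0 0) 0 True) X hX)
  have e1 : ε - 0 = ε := sub_zero ε
  have e2 : ρ - 0 = ρ := sub_zero ρ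
  have e3 : c.κ₁ * ((1 : ℕ) : ℝ) = c.κ₁ := by simp
  have e4 : {ω : Unit | (({j₀} : Finset (TPt d N'))).Nonempty} = (Set.univ : Set Unit) := by ext; simp
  rw [e1, e2, e3, e4] at h
  exact h

end NonVacuity

/-! ## §4. Print's located dichotomy (p. 5, the two sentences after (1.11)) ⟹ the absorption binder

The ABSORPTION HYPOTHESIS `habs : κ₁·m(ω) ≤ κ₁·m₀ + η·D_ω(a,b)` of §1–§2 is DISCHARGED here from the two clauses the text
locates on p. 5 (verbatim in the CITATION HEADER).  (P1) THE DICHOTOMY PER WALK: *"If m is big enough, for example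
m > 2⁴, then δ₀d(ω) ≥ δ₁mM, for a positive constant δ₁ depending on δ₀ only … If m ≤ 2⁴, then we can have short walks"*
— in the expansion's currency `m(ω) ≤ m₀ ∨ ∀ a b, δ₁M·m(ω) ≤ ρ·D_ω(a,b)` (`ρ` = print's walk rate `δ₀` of (1.7);
`D_ω(a,b)` = the walk distance `d(ω,a,b)` of [13] (3.93) p. 410, an infimum of lengths of polygons from `a` to `b`
through one point of every localization domain of `ω` — each such polygon is a connected graph meeting all the domains,
so `d(ω,a,b) ≥ d(ω)` = the length of a shortest tree graph meeting them, and print's sentence, stated with `d(ω)`,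
IMPLIES (P1) for every pair of endpoints).  (P2) THE RESTRICTION ON THE CONSTANTS: *"for δ₁M ≥ κ₁"*, with the ABSORBED
RATE `η` made explicit: `κ₁·ρ ≤ η·δ₁M`.  Print absorbs the monomial `e^{mκ₁}` into the WHOLE factor `exp(−δ₀d(ω))`
(p. 3: *"The first two factors in (1.7) are used to control the sum over ω, and they determine the constant B₀. We will
use the remaining two factors to produce exponential bounds for localized terms"*) — in the tree's package
`(ρ, ε, κ, K̄)` that is the case drop `ε = ρ` (the amplitudes ALONE have bounded row sums), where `η = ρ` is admissible
and (P2) reads LITERALLY `κ₁ ≤ δ₁M` (`sDecorate_entry_le_R1` — a literal but, in the tree's entrywise currency, not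
volume-uniform instance: see the caveat there); a package whose row sums keep part of the walk decay (`ε < ρ`, the
volume-uniform packages of the tree) can absorb only `η ≤ ε`, and (P2) is then the slack `δ₁M ≥ (ρ/η)κ₁` recorded by
the cell's referee-reader on the first edition of this file (`jointWalkExpansion_sDecorate_printed`: `η = ε`).  The
geometric CONTENT of (P1) for Bałaban's walks (cubes of `σ₀` of size `M` meeting
thickened domains of size `O(M₁)`) is NOT proved here — other carrier: its as-printed form (no size threshold) FAILS,
`B13WalkCubes111.printed111_fails`, and its repaired form `m ≤ 2^d ∨ δ₁mM ≤ δ₀d(ω)` with `δ₁ = δ₀(1 − 2τ)/(4·2^d)` under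
`2τ < 1` is `B13WalkCubes111.walkCubes_dichotomy_walkLen` ∕ `ineq111_long` (continuum model of `TreeLength`; cited, not
imported); here (P1) is a HYPOTHESIS on the walk data, exactly as the text uses it. -/

/-- **THE ARITHMETIC OF PRINT'S TWO SENTENCES** (per walk `ω` and pair of endpoints `a, b`): the dichotomy (P1)
`m(ω) ≤ m₀ ∨ ∀ a b, δ₁M·m(ω) ≤ ρ·D_ω(a,b)` and the restriction (P2) `κ₁ρ ≤ η·δ₁M` (`κ₁, η ≥ 0`, `δ₁M > 0`, `D ≥ 0`)
give the absorption hypothesis of `norm_sTerm_le` ∕ `jointWalkExpansion_sDecorate`: `κ₁·m(ω) ≤ κ₁·m₀ + η·D_ω(a,b)` —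
short walks pay the constant `e^{κ₁m₀}` (*"the expression can be bounded by e^{16κ₁} only"*), long walks pay with the
rate `η` (*"we can bound the expression under the supremum in (1.11) by 1, for δ₁M ≥ κ₁"*: `e^{κ₁m(ω)} ≤ e^{ηD_ω(a,b)}`).
Pure real arithmetic; `dM` stands for print's `δ₁M`. [cite: Balaban1988RG2Cluster, (1.11) p.5] -/
theorem absorb_of_dichotomy {α : Type*} {D : W → α → α → ℝ} {κ₁ ρ η dM : ℝ} {m₀ : ℕ} (hκ₁ : 0 ≤ κ₁)
    (hD : ∀ ω a b, 0 ≤ D ω a b) (hdM : 0 < dM) (hη : 0 ≤ η)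
    (hdich : ∀ ω, (J ω).card ≤ m₀ ∨ ∀ a b, dM * (J ω).card ≤ ρ * D ω a b) (hR1 : κ₁ * ρ ≤ η * dM) :
    ∀ ω a b, κ₁ * (J ω).card ≤ κ₁ * m₀ + η * D ω a b := by
  intro ω a b
  have h3 : 0 ≤ κ₁ * (m₀ : ℝ) := mul_nonneg hκ₁ (Nat.cast_nonneg _)
  have h2 : 0 ≤ η * D ω a b := mul_nonneg hη (hD ω a b)
  rcases hdich ω with hm | hlong
  · -- short walk: `m ≤ m₀`
    have h1 : κ₁ * ((J ω).card : ℝ) ≤ κ₁ * m₀ := mul_le_mul_of_nonneg_left (by exact_mod_cast hm) hκ₁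
    linarith
  · -- long walk: `δ₁M·m ≤ ρD`, so `δ₁M·(κ₁m) ≤ κ₁ρ·D ≤ η·δ₁M·D`
    have key : dM * (κ₁ * (J ω).card) ≤ dM * (η * D ω a b) :=
      calc dM * (κ₁ * (J ω).card) = κ₁ * (dM * (J ω).card) := by ring
        _ ≤ κ₁ * (ρ * D ω a b) := mul_le_mul_of_nonneg_left (hlong a b) hκ₁
        _ = (κ₁ * ρ) * D ω a b := by ring
        _ ≤ (η * dM) * D ω a b := mul_le_mul_of_nonneg_right hR1 (hD ω a b)
        _ = dM * (η * D ω a b) := by ring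
    have h4 : κ₁ * ((J ω).card : ℝ) ≤ η * D ω a b := le_of_mul_le_mul_left key hdM
    linarith

/-- **PRINT'S SENTENCE IN ITS OWN CURRENCY ⟹ (P1).**  If every walk `ω` carries a length `d(ω)` (the length of a
shortest tree graph intersecting all localization domains of `ω`) with print's dichotomy VERBATIM,
`m(ω) ≤ m₀ ∨ δ₁M·m(ω) ≤ ρ·d(ω)` (*"If m is big enough, for example m > 2⁴, then δ₀d(ω) ≥ δ₁mM"*, `ρ` = `δ₀`), and the
walk distances dominate it, `d(ω) ≤ D_ω(a,b)` for all endpoints ([13] (3.93): `d(ω,a,b)` is an infimum of lengths of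
polygons from `a` to `b` through one point of every domain of `ω` — connected graphs meeting all the domains, hence not
shorter than the shortest tree; cf. `B13WalkCubes111.walkCubes_dichotomy_path`), then (P1) holds at every pair of
endpoints (`ρ ≥ 0`). [cite: Balaban1988RG2Cluster, (1.11) p.5; Balaban1985BackgroundPropagators, (3.93) p.410] -/
theorem dichotomy_of_treeLength {α : Type*} {D : W → α → α → ℝ} {dω : W → ℝ} {ρ dM : ℝ} {m₀ : ℕ} (hρ : 0 ≤ ρ)
    (hgeo : ∀ ω, (J ω).card ≤ m₀ ∨ dM * (J ω).card ≤ ρ * dω ω) (hdom : ∀ ω a b, dω ω ≤ D ω a b) :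
    ∀ ω, (J ω).card ≤ m₀ ∨ ∀ a b, dM * (J ω).card ≤ ρ * D ω a b := fun ω =>
  (hgeo ω).imp_right fun h a b => h.trans (mul_le_mul_of_nonneg_left (hdom ω a b) hρ)

section Dichotomy

variable [NormedAddCommGroup E] [NormedSpace ℂ E]
variable {c : B13.Consts} {locp : p → UT Nf} {locn : n → UT Nf} {K₀ : E → Matrix p n ℂ}
variable {X : Finset (UT Nf)} {R ε kap Kbar : ℝ} {SX₀ : Set W} {A : W → ℝ} {D : W → UT Nf → UT Nf → ℝ} {ρ : ℝ}
variable {J T₀}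

/-- **THE s-DECOUPLED EXPANSION FROM PRINT'S DICHOTOMY** (§2's `jointWalkExpansion_sDecorate` with its absorption binder
DISCHARGED by `absorb_of_dichotomy`).  DATA: the σ-free joint walk expansion of `K₀(u) = Σ_ω T_ω(u)` (package
`(ρ, ε, κ, K̄)`), the decoration `J(ω)` (the σ₀-cubes meeting the localization of `ω`, `m(ω) = |J(ω)|`), print's dichotomy
(P1) `m(ω) ≤ m₀ ∨ ∀ a b, δ₁M·m(ω) ≤ ρ·D_ω(a,b)` on the walk data (`δ₁M > 0`), print's restriction (P2) `κ₁ρ ≤ η·δ₁M` for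
an absorbed rate `0 ≤ η ≤ ε`, and the geometric clause that a walk picking up a parameter passes through the σ-region
`X`.  CONCLUSION, as in §2: `K(s,u) = Σ_ω (∏_{Δ∈J(ω)} s(Δ))T_ω(u)` is a joint walk expansion on the polydisc
`‖s(Δ)‖ ≤ e^{κ₁}` × the `R`-ball with terms `sTerm J T₀`, σ-carrying sub-family `{ω | J(ω) ≠ ∅}`, amplitudes `e^{κ₁m₀}A_ω`,
the SAME walk distances, rate `ρ − η`, drop `ε − η`, torus rate `κ`, constant `e^{κ₁m₀}K̄`. [cite: Balaban1988RG2Cluster, (1.11) p.5, p.3 (after (1.7)), p.13; Balaban1985BackgroundPropagators, (3.93) p.410, Thm 3.10 p.416] -/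
theorem jointWalkExpansion_sDecorate_of_dichotomy (hκ₁ : 0 ≤ c.κ₁)
    (h₀ : JointWalkExpansion c locp locn (fun (_ : TPt d N' → ℂ) => K₀) X R ε kap Kbar
      (fun ω (_ : TPt d N' → ℂ) => T₀ ω) SX₀ A D ρ)
    (J : W → Finset (TPt d N')) {m₀ : ℕ} {dM η : ℝ} (hdM : 0 < dM) (hη : 0 ≤ η) (hηε : η ≤ ε)
    (hdich : ∀ ω, (J ω).card ≤ m₀ ∨ ∀ a b, dM * (J ω).card ≤ ρ * D ω a b) (hR1 : c.κ₁ * ρ ≤ η * dM)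
    (hX : ∀ ω, (J ω).Nonempty → Through (toB6 (torusGeom Nf 0 0 0) 0 True) (D ω) (↑X : Set (UT Nf))) :
    JointWalkExpansion c locp locn (sDecorate J T₀) X R (ε - η) kap (Real.exp (c.κ₁ * m₀) * Kbar)
      (sTerm J T₀) {ω | (J ω).Nonempty} (fun ω => Real.exp (c.κ₁ * m₀) * A ω) D (ρ - η) :=
  jointWalkExpansion_sDecorate hκ₁ h₀ J hηε (absorb_of_dichotomy J hκ₁ h₀.D_nonneg hdM hη hdich hR1) hX

/-- **THE (1.11) BOUND FROM PRINT'S DICHOTOMY**: `‖K(s,u)(i,j)‖ ≤ e^{κ₁m₀}K̄·e^{−κd₁(loc i, loc j)}` on polydisc × ball —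
§2's `sDecorate_entry_le` with the absorption binder discharged by (P1) + (P2). [cite: Balaban1988RG2Cluster, (1.11) p.5] -/
theorem sDecorate_entry_le_of_dichotomy (hκ₁ : 0 ≤ c.κ₁)
    (h₀ : JointWalkExpansion c locp locn (fun (_ : TPt d N' → ℂ) => K₀) X R ε kap Kbar
      (fun ω (_ : TPt d N' → ℂ) => T₀ ω) SX₀ A D ρ)
    (J : W → Finset (TPt d N')) {m₀ : ℕ} {dM η : ℝ} (hdM : 0 < dM) (hη : 0 ≤ η) (hηε : η ≤ ε)
    (hdich : ∀ ω, (J ω).card ≤ m₀ ∨ ∀ a b, dM * (J ω).card ≤ ρ * D ω a b) (hR1 : c.κ₁ * ρ ≤ η * dM)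
    (hX : ∀ ω, (J ω).Nonempty → Through (toB6 (torusGeom Nf 0 0 0) 0 True) (D ω) (↑X : Set (UT Nf))) :
    ∀ σ : TPt d N' → ℂ, (∀ j, ‖σ j‖ ≤ Real.exp c.κ₁) → ∀ u ∈ ball (0 : E) R,
      ∀ i j, ‖sDecorate J T₀ σ u i j‖ ≤
        (Real.exp (c.κ₁ * m₀) * Kbar) * Real.exp (-(kap * tdist1 Nf (locp i) (locn j))) :=
  (jointWalkExpansion_sDecorate_of_dichotomy hκ₁ h₀ J hdM hη hηε hdich hR1 hX).majorants (sub_nonneg.2 hηε)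

/-- **PRINT'S INSTANCE `m₀ = 2⁴`, ABSORBED RATE `η = ε`** — the Hölder split of (1.11): the amplitudes' row sums (*"the
first two factors in (1.7) … control the sum over ω"*) times the supremum over `ω` of the remaining factor
`e^{−εD_ω}·e^{κ₁m(ω)}`, which (P1) + (P2) `κ₁ρ ≤ ε·δ₁M` bound by `e^{16κ₁}` (long walks by `1`, short walks by `e^{16κ₁}`):
the s-dependent kernel is a joint walk expansion with amplitudes `e^{16κ₁}A_ω`, rate `ρ − ε`, drop `0`, torus rate `κ`,
constant `e^{16κ₁}K̄` — *"an analytic function of the variables s(Y₀) on the domain |s(Y₀)| ≤ e^{κ₁}, bounded by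
B₀e^{16κ₁}|X|"*. [cite: Balaban1988RG2Cluster, (1.11) p.5, p.3 (after (1.7))] -/
theorem jointWalkExpansion_sDecorate_printed (hκ₁ : 0 ≤ c.κ₁)
    (h₀ : JointWalkExpansion c locp locn (fun (_ : TPt d N' → ℂ) => K₀) X R ε kap Kbar
      (fun ω (_ : TPt d N' → ℂ) => T₀ ω) SX₀ A D ρ)
    (J : W → Finset (TPt d N')) {dM : ℝ} (hdM : 0 < dM) (hε : 0 ≤ ε)
    (hdich : ∀ ω, (J ω).card ≤ 2 ^ 4 ∨ ∀ a b, dM * (J ω).card ≤ ρ * D ω a b) (hR1 : c.κ₁ * ρ ≤ ε * dM)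
    (hX : ∀ ω, (J ω).Nonempty → Through (toB6 (torusGeom Nf 0 0 0) 0 True) (D ω) (↑X : Set (UT Nf))) :
    JointWalkExpansion c locp locn (sDecorate J T₀) X R 0 kap (Real.exp (16 * c.κ₁) * Kbar)
      (sTerm J T₀) {ω | (J ω).Nonempty} (fun ω => Real.exp (16 * c.κ₁) * A ω) D (ρ - ε) := by
  have h := jointWalkExpansion_sDecorate_of_dichotomy hκ₁ h₀ J (m₀ := 2 ^ 4) hdM hε le_rfl hdich hR1 hX
  have e1 : ε - ε = 0 := sub_self ε
  have e2 : c.κ₁ * ((2 ^ 4 : ℕ) : ℝ) = 16 * c.κ₁ := by push_cast; ring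
  rw [e1, e2] at h
  exact h

/-- **PRINT'S OWN PACKAGE: THE RESTRICTION LITERALLY `δ₁M ≥ κ₁`.**  When the amplitudes ALONE have bounded row sums
(drop `ε = ρ` — print's reading of (1.7): the combinatorial factors `O(1)O(M₁^{−½})^{|ω|}` control the sum over `ω`,
the WHOLE decay `exp(−δ₀d(ω))` is spare), the absorbed rate may be `η = ρ = δ₀` and (P2) is print's restriction
verbatim, `κ₁ ≤ δ₁M` (`ρ ≥ 0`): the s-dependent kernel obeys the (1.11) bound `‖K(s,u)(i,j)‖ ≤ e^{16κ₁}K̄·e^{−κd₁(loc i, loc j)}`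
on the polydisc `‖s(Δ)‖ ≤ e^{κ₁}` × the `R`-ball — *"bounded by B₀e^{16κ₁}|X|"* (`B₀|X|` ↔ `K̄`; torus rate `κ` as the
package carries it, `κ = 0` in print's sup-norm sentence).  CAVEAT (currency): in the tree's ENTRYWISE packaging a
drop-`ρ` package bounds the total amplitude mass `Σ_ω A_ω` over the whole torus (print sums the combinatorial factors
over walks from a FIXED cube), so this literal instance is not volume-uniform; the uniform reading of the same sentence
is `jointWalkExpansion_sDecorate_printed` (absorbed rate = the drop `ε`, (P2) `κ₁ρ ≤ ε·δ₁M`). [cite: Balaban1988RG2Cluster, (1.11) p.5, (1.7) p.3] -/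
theorem sDecorate_entry_le_R1 (hκ₁ : 0 ≤ c.κ₁) (hρ : 0 ≤ ρ)
    (h₀ : JointWalkExpansion c locp locn (fun (_ : TPt d N' → ℂ) => K₀) X R ρ kap Kbar
      (fun ω (_ : TPt d N' → ℂ) => T₀ ω) SX₀ A D ρ)
    (J : W → Finset (TPt d N')) {dM : ℝ} (hdM : 0 < dM)
    (hdich : ∀ ω, (J ω).card ≤ 2 ^ 4 ∨ ∀ a b, dM * (J ω).card ≤ ρ * D ω a b) (hR1 : c.κ₁ ≤ dM)
    (hX : ∀ ω, (J ω).Nonempty → Through (toB6 (torusGeom Nf 0 0 0) 0 True) (D ω) (↑X : Set (UT Nf))) :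
    ∀ σ : TPt d N' → ℂ, (∀ j, ‖σ j‖ ≤ Real.exp c.κ₁) → ∀ u ∈ ball (0 : E) R,
      ∀ i j, ‖sDecorate J T₀ σ u i j‖ ≤
        (Real.exp (16 * c.κ₁) * Kbar) * Real.exp (-(kap * tdist1 Nf (locp i) (locn j))) := by
  have hR1' : c.κ₁ * ρ ≤ ρ * dM := by
    rw [mul_comm ρ dM]
    exact mul_le_mul_of_nonneg_right hR1 hρ
  exact (jointWalkExpansion_sDecorate_printed hκ₁ h₀ J hdM hρ hdich hR1' hX).majorants le_rfl

end Dichotomy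

/-! ## §5. Non-vacuity with the LONG branch of the dichotomy active -/

section NonVacuityLong

variable [NormedAddCommGroup E] [NormedSpace ℂ E]
variable {c : B13.Consts} {locp : p → UT Nf} {locn : n → UT Nf}

/-- **The dichotomy road is inhabited by a LONG walk** (`m = |Y| > 2⁴`, so (P1) holds through its SECOND branch): a
σ-free, u-free kernel `K₀` read as ONE term meeting the `m > 2⁴` cubes `Y` of `σ₀`, localised through a non-empty `X`
with the walk distance `D(a,b) = D_X(a,b) + ℓ` ((3.93): one junction in `X` plus a length `ℓ ≥ 0` run inside the
domains — it dominates `d₁` and passes through `X`), `‖K₀(i,j)‖ ≤ A₀e^{−ρD(loc i, loc j)}`, the long branch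
`δ₁M·m ≤ ρℓ`, (P2) `κ₁ρ ≤ ε·δ₁M`, rates `0 ≤ κ ≤ ρ − ε`, `ε ≥ 0`: by `jointWalkExpansion_sDecorate_printed`,
`K(s) = (∏_{Δ∈Y} s(Δ))·K₀` is a joint walk expansion whose only term carries σ (`SX = univ`) and passes through `X`,
with amplitude and constant `e^{16κ₁}A₀`, rate `ρ − ε`, drop `0`, torus rate `κ`.  All hypotheses of §4 are thus
jointly satisfiable with the long branch in use (torus-uniformly: nothing depends on the size of the torus).
[cite: Balaban1988RG2Cluster, (1.11) p.5, p.13; Balaban1985BackgroundPropagators, (3.93) p.410] -/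
theorem jointWalkExpansion_sDecorate_longWalk (hκ₁ : 0 ≤ c.κ₁) (K₀ : Matrix p n ℂ) {X : Finset (UT Nf)}
    (hX : X.Nonempty) {R ε kap A₀ ρ dM ℓ : ℝ} (hA₀ : 0 ≤ A₀) (hε : 0 ≤ ε) (hkap : 0 ≤ kap) (hκρ : kap ≤ ρ - ε)
    (hℓ : 0 ≤ ℓ) (hdM : 0 < dM) (Y : Finset (TPt d N')) (hYlong : 2 ^ 4 < Y.card) (hY : dM * Y.card ≤ ρ * ℓ)
    (hR1 : c.κ₁ * ρ ≤ ε * dM)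
    (hmaj : ∀ i j, ‖K₀ i j‖ ≤ A₀ *
      Real.exp (-(ρ * (passDist (g := toB6 (torusGeom Nf 0 0 0) 0 True) X hX (locp i) (locn j) + ℓ)))) :
    JointWalkExpansion c locp locn (sDecorate (fun _ : Unit => Y) (fun (_ : Unit) (_ : E) => K₀))
      X R 0 kap (Real.exp (16 * c.κ₁) * A₀)
      (sTerm (fun _ : Unit => Y) (fun (_ : Unit) (_ : E) => K₀))
      (Set.univ : Set Unit) (fun _ => Real.exp (16 * c.κ₁) * A₀)
      (fun _ a b => passDist (g := toB6 (torusGeom Nf 0 0 0) 0 True) X hX a b + ℓ) (ρ - ε) := by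
  have hρ : 0 ≤ ρ := by linarith
  have hρε : 0 ≤ ρ - ε := by linarith
  -- the walk distance `D_X + ℓ`: non-negative, dominates `d₁`, passes through `X`
  have hdom : ∀ a b : UT Nf, tdist1 Nf a b ≤ passDist (g := toB6 (torusGeom Nf 0 0 0) 0 True) X hX a b :=
    fun a b => domBy_passDist (htri_torusGeom 0 0 0 0 True) X hX a b
  have hP : ∀ a b : UT Nf, 0 ≤ passDist (g := toB6 (torusGeom Nf 0 0 0) 0 True) X hX a b := fun a b =>
    (tdist1_nonneg a b).trans (hdom a b)
  have hD₀ : ∀ a b : UT Nf, 0 ≤ passDist (g := toB6 (torusGeom Nf 0 0 0) 0 True) X hX a b + ℓ := fun a b =>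
    add_nonneg (hP a b) hℓ
  have hthr : Through (toB6 (torusGeom Nf 0 0 0) 0 True)
      (fun a b => passDist (g := toB6 (torusGeom Nf 0 0 0) 0 True) X hX a b + ℓ) (↑X : Set (UT Nf)) := by
    intro y y'
    obtain ⟨z, hz, hle⟩ := through_passDist (g := toB6 (torusGeom Nf 0 0 0) 0 True) X hX y y'
    exact ⟨z, hz, hle.trans (le_add_of_nonneg_right hℓ)⟩
  have hsum : MajSumLe (g := toB6 (torusGeom Nf 0 0 0) 0 True)
      (fun (_ : Unit) a b => A₀ * Real.exp (-((ρ - ε) *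
        (passDist (g := toB6 (torusGeom Nf 0 0 0) 0 True) X hX a b + ℓ))))
      (fun a b => A₀ * Real.exp (-(kap * tdist1 Nf a b))) := by
    intro S a b
    have h1 : A₀ * Real.exp (-((ρ - ε) * (passDist (g := toB6 (torusGeom Nf 0 0 0) 0 True) X hX a b + ℓ))) ≤
        A₀ * Real.exp (-(kap * tdist1 Nf a b)) := by
      refine mul_le_mul_of_nonneg_left (Real.exp_le_exp.2 (neg_le_neg ?_)) hA₀
      calc kap * tdist1 Nf a b ≤ kap * passDist (g := toB6 (torusGeom Nf 0 0 0) 0 True) X hX a b :=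
            mul_le_mul_of_nonneg_left (hdom a b) hkap
        _ ≤ (ρ - ε) * passDist (g := toB6 (torusGeom Nf 0 0 0) 0 True) X hX a b :=
            mul_le_mul_of_nonneg_right hκρ (hP a b)
        _ ≤ (ρ - ε) * (passDist (g := toB6 (torusGeom Nf 0 0 0) 0 True) X hX a b + ℓ) :=
            mul_le_mul_of_nonneg_left (le_add_of_nonneg_right hℓ) hρε
    calc ∑ _ω ∈ S, A₀ * Real.exp (-((ρ - ε) * (passDist (g := toB6 (torusGeom Nf 0 0 0) 0 True) X hX a b + ℓ)))
        ≤ ∑ _ω ∈ (Finset.univ : Finset Unit),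
            A₀ * Real.exp (-((ρ - ε) * (passDist (g := toB6 (torusGeom Nf 0 0 0) 0 True) X hX a b + ℓ))) :=
          Finset.sum_le_sum_of_subset_of_nonneg (Finset.subset_univ S) fun _ _ _ =>
            mul_nonneg hA₀ (Real.exp_pos _).le
      _ = A₀ * Real.exp (-((ρ - ε) * (passDist (g := toB6 (torusGeom Nf 0 0 0) 0 True) X hX a b + ℓ))) := by simp
      _ ≤ A₀ * Real.exp (-(kap * tdist1 Nf a b)) := h1
  have h₀ := jointWalkExpansion_const (d := d) (N' := N') (E := E) c locp locn K₀ X (R := R) (ε := ε) hA₀ hD₀ hmaj hsum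
  -- (P1) through its LONG branch: `δ₁M·|Y| ≤ ρℓ ≤ ρ(D_X + ℓ)`
  have hdich : ∀ _ω : Unit, Y.card ≤ 2 ^ 4 ∨ ∀ a b : UT Nf,
      dM * Y.card ≤ ρ * (passDist (g := toB6 (torusGeom Nf 0 0 0) 0 True) X hX a b + ℓ) := fun _ =>
    Or.inr fun a b => by
      have h0 : 0 ≤ ρ * passDist (g := toB6 (torusGeom Nf 0 0 0) 0 True) X hX a b := mul_nonneg hρ (hP a b)
      rw [mul_add]
      linarith
  have h := jointWalkExpansion_sDecorate_printed (SX₀ := (∅ : Set Unit)) hκ₁ h₀ (fun _ => Y) hdM hε hdich hR1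
    (fun _ _ => hthr)
  have hYne : Y.Nonempty := Finset.card_pos.1 (lt_of_le_of_lt (Nat.zero_le _) hYlong)
  have e4 : {ω : Unit | Y.Nonempty} = (Set.univ : Set Unit) := by
    ext
    simp [hYne]
  rw [e4] at h
  exact h

end NonVacuityLong

end Literature.MathematicalPhysics.QuantumFieldTheory.Balaban1983to89.B13Eq111SDecoupling

end
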